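import Mathlib
import HarnessLib
import Literature.Analysis.ValidatedNumerics.UnivariateIntervalNewtonIteration

/-!
# Rates for the univariate interval Newton iteration (5.16): QUADRATIC CONVERGENCE of the widths
# under a Lipschitz-width derivative enclosure (Alefeld–Mayer Thm 5(b)), the one-step DIVERGENCE
# TEST `|f(m)| > |F'(X)|·w(X) ⇒ X ∩ N(X) = ∅`, and FINITE TERMINATION on zero-free intervals for
# ARBITRARY evaluation points `m[x] ∈ [x]` with explicit step counts (Alefeld–Mayer Thm 5(c))

Topic `Literature/Analysis/ValidatedNumerics`.  Everything here is PROVED; no named fact, no axiom.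

`UnivariateIntervalNewtonIteration.lean` typed Moore's iteration `X⁽ᵏ⁺¹⁾ = X⁽ᵏ⁾ ∩ N(X⁽ᵏ⁾)`,
`N(X) = m − f(m)/F'(X)` [Moore1979, §5.2 (5.16)] as the predicates `IsNewtonRun` (what an outward
rounded run satisfies) and `IsExactNewtonRun` (Moore's exact midpoint recipe), with the HALVING rate
`w(X⁽ᵏ⁺¹⁾) ≤ ½ w(X⁽ᵏ⁾)` and the termination dichotomy for midpoint runs.  Its docstring lists as NOT
there: *"quadratic convergence of the widths under a Lipschitz `F'` (Moore does not state it in §5.2;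
Alefeld–Herzberger)"*.  This file types exactly that, from the statement of the univariate interval
Newton method in Alefeld–Mayer's survey [AlefeldMayer2000, §3, (17)–(19), Theorem 5] — where, NOTE,
the evaluation point is ARBITRARY, `m[x] ∈ [x]`, not the midpoint:

*"Theorem 5. (a) If `N[x] ⊆ [x] ⊆ [x]⁰` then `f` has a zero `x* ∈ [x]` which is unique in `[x]⁰`.
(b) If `f` has a zero `x* ∈ [x]⁰` then `{[x]ᵏ}` is well defined, `x* ∈ [x]ᵏ` and `lim [x]ᵏ = x*`.
If `d f'([x]) ≤ c·d[x]`, `[x] ⊆ [x]⁰`, then `d[x]ᵏ⁺¹ ≤ γ (d[x]ᵏ)²`.  (c) `N[x]^{k₀} ∩ [x]^{k₀} = ∅` for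
some `k₀ ≥ 0` if and only if `f(x) ≠ 0` for all `x ∈ [x]⁰`."*  (The same theorem, with the same
proof references, is Theorem 3 of Alefeld's NATO lecture notes, in Bulgak–Zenger (eds.), *Error Control
and Adaptivity in Scientific Computing* (1999).)  Part (a) is `UnivariateIntervalNewton.lean`
(`exists_zero_of_newtonSet_subset`, `zero_unique_of_deriv_enclosure`); retention `x* ∈ [x]ᵏ` and the
"only if" of (c) hold for every `IsNewtonRun` (`zero_mem`, `forall_ne_zero_of_lt`).  Typed here:

* **(b), quadratic convergence** — the one-step metric fact behind it, `w(N(X)) ≤ |f(m)|·(d̄ − d̲)/δ²`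
  for `F'(X) = [d̲, d̄]` with `|F'(X)| ≥ δ > 0` (`abs_sub_le_width_of_mem_newtonSet`), `|f(mₖ)| ≤ M·w(X⁽ᵏ⁾)`
  once a zero lies in `X⁽⁰⁾` and `|F'(X⁽ᵏ⁾)| ≤ M` (`IsNewtonRun.abs_apply_center_le_mul_width`), and the
  theorem: along a run with `X⁽ᵏ⁺¹⁾ ⊆ N(X⁽ᵏ⁾)`, `δ ≤ |F'(X⁽ᵏ⁾)| ≤ M` and `w(F'(X⁽ᵏ⁾)) ≤ c·w(X⁽ᵏ⁾)`,
  `w(X⁽ᵏ⁺¹⁾) ≤ (M c/δ²)·w(X⁽ᵏ⁾)²` (`IsNewtonRun.width_succ_le_mul_sq`; with nested enclosures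
  `F'(X⁽ᵏ⁾) ⊆ F'(X⁽⁰⁾) = [d̲₀, d̄₀]` one may take `δ = min(|d̲₀|,|d̄₀|)`, `M = max(|d̲₀|,|d̄₀|)`:
  `width_succ_le_mul_sq_of_subset`, and for Moore's exact midpoint runs BOTH rates at once,
  `IsExactNewtonRun.width_succ_le_min`).  The constant `γ = M c/δ²` is the one the standard proof gives
  (Alefeld–Herzberger); Alefeld–Mayer leave `γ` unnamed.
* **the divergence test** — the univariate case of [AlefeldMayer2000, §4 (37)–(40)] ("quadratic
  divergence"): if `m ∈ X`, `0 ∉ F'(X)`, `|F'(X)| ≤ M` and `|f(m)| > M·w(X)` then `X ∩ N(X) = ∅`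
  (`Icc_inter_newtonSet_eq_empty`; along an exact run the next iterate is empty,
  `IsNewtonRun.lt_of_mul_width_lt`).
* **(c), "if", for arbitrary `m[x] ∈ [x]`, with step counts** — our proof, since the survey gives none
  and Moore's halving argument needs the midpoint: if `|f| ≥ μ > 0` on `X⁽⁰⁾` then consecutive
  evaluation points satisfy `mₖ − mₖ₊₁ = f(mₖ)/dₖ`, `dₖ ∈ F'(X⁽ᵏ⁾) ⊆ F'(X⁽⁰⁾)`, all of ONE sign (no zero
  of `f` between two `m`'s by the intermediate value theorem, none of `F'` since `0 ∉ F'(X⁽⁰⁾)`) and of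
  size `≥ μ/M`; so the `mₖ` drift monotonically out of `X⁽⁰⁾` and an empty iterate occurs at some
  `k ≤ ⌊M·w(X⁽⁰⁾)/μ⌋ + 1` (`IsNewtonRun.exists_lt_of_le_abs`; qualitative form via compactness
  `IsNewtonRun.exists_Icc_eq_empty_of_forall_ne_zero`, and the dichotomy
  `exists_Icc_eq_empty_iff_forall_ne_zero` for every exact run with nested enclosures —
  `UnivariateIntervalNewtonIteration.lean` had it for midpoint runs only).  For MIDPOINT runs the divergence test and halving give the logarithmic count instead:
  `w(X⁽⁰⁾) < (μ/M)·2ⁿ ⇒` some `X⁽ᵏ⁾ = ∅` with `k ≤ n + 1` (`IsExactNewtonRun.exists_lt_of_width_lt`) —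
  Alefeld–Mayer's remark that *"k₀ is small if the diameter of `[x]⁰` is small"*.

Worked numbers (`sqrtTwo_step_two_width_le`, `_numbers`): on the second step of the `x² − 2` run of
the two earlier files (`X⁽¹⁾ = [11/8, 23/16]`, `m = 45/32`, `F'(X⁽¹⁾) = [11/4, 23/8]`, `f(m) = −23/1024`)
the one-step bound reads `w(N(X⁽¹⁾)) ≤ (23/1024)·(1/8)/(11/4)² = 23/61952 ≈ 3.71·10⁻⁴` against the true
`w(X⁽²⁾) = 1/2816 ≈ 3.55·10⁻⁴` (halving promised `1/32`); for this `f`, `F'(X) = 2X` gives `c = 2`,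
`M = 4`, `δ = 2`, `γ = 2`.

Motivation and first use: the a-priori step counts a univariate root isolator may quote when it runs
(5.16) to EXCLUDE a box (the H21 engines group's `cap` kernels do this before a Krawczyk/Taylor-model
certificate; shared numerical engines serve client cells, rigour lives in the verifiers, and nothing
here is a claim about any engine output — the theorems say what such a run proves).

NOT here: the general-`m` CONVERGENCE `lim [x]ᵏ = x*` of Thm 5(b) without a rate hypothesis; the
`n`-dimensional statements (33)–(42) of [AlefeldMayer2000, §4] (Krawczyk/Newton operators in `ℝⁿ`:
`KrawczykIterationConvergence.lean`, `HansenSenguptaOperator.lean`); extended division (Moore (5.17)).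
Nearest in-tree statements: `IsExactNewtonRun.width_succ_le` / `width_le_div_pow` (halving, which the
quadratic bound sharpens for small widths), `IsExactNewtonRun.exists_lt_iff_forall_ne_zero` (midpoint-only
dichotomy, generalised here), `IntervalNewton.abs_sub_le_of_mem_newtonSet_Icc` (position of `N(X)`
relative to `m`, not its width), `IsKrawczykIteration.width_le_pow` (geometric rate in `ℝⁿ`).

## References

* G. Alefeld, G. Mayer, Interval analysis: theory and applications, *J. Comput. Appl. Math.* 121
  (2000) 421–464, §3 (17)–(19) and Theorem 5 (p. 430), §4 (37)–(42) (quadratic divergence, p. 435).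
  [cite: AlefeldMayer2000, §3 Thm 5(b)(c); §4 (37)–(40)]
* G. Alefeld, Interval arithmetic tools for range approximation and inclusion of zeros, in H. Bulgak,
  C. Zenger (eds.), *Error Control and Adaptivity in Scientific Computing*, NATO Sci. Ser. C 536,
  Kluwer (1999), Theorem 3 (same statement). doi:10.1007/978-94-011-4647-0
* R. E. Moore, *Methods and Applications of Interval Analysis*, SIAM (1979), §5.2 (5.16), Thm 5.5.
  [cite: Moore1979, §5.2 (5.16), Thm 5.5]
-/

open Set Filter Topology

namespace Literature.Analysis.ValidatedNumerics.IntervalNewton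

/-! ## One-step metric facts about `N(X) = m − f(m)/F'(X)` over `F'(X) = [d̲, d̄] ∌ 0` -/

section OneStep

variable {m fm dl du : ℝ}

/-- For an interval `[a, b] ∌ 0` and `d ∈ [a, b]`: `min(|a|,|b|) ≤ |d| ≤ max(|a|,|b|)` (plumbing for the
choices `δ = min`, `M = max`) [folklore]. -/
private theorem abs_bounds_of_mem {a b d : ℝ} (h0 : (0 : ℝ) ∉ Icc a b) (hd : d ∈ Icc a b) :
    min |a| |b| ≤ |d| ∧ |d| ≤ max |a| |b| := by
  rcases lt_or_ge 0 a with ha | ha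
  · have hd0 : 0 < d := ha.trans_le hd.1
    rw [abs_of_pos ha, abs_of_pos hd0, abs_of_pos (hd0.trans_le hd.2)]
    exact ⟨min_le_of_left_le hd.1, le_max_of_le_right hd.2⟩
  · have hb : b < 0 := lt_of_not_ge fun hb => h0 ⟨ha, hb⟩
    have hd0 : d < 0 := lt_of_le_of_lt hd.2 hb
    rw [abs_of_neg hb, abs_of_neg hd0, abs_of_nonpos ha]
    exact ⟨min_le_of_right_le (by linarith [hd.2]), le_max_of_le_left (by linarith [hd.1])⟩

/-- For a nonempty interval `[a, b] ∌ 0`: `0 < min(|a|,|b|)` [folklore]. -/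
private theorem min_abs_pos {a b : ℝ} (h0 : (0 : ℝ) ∉ Icc a b) (hab : a ≤ b) : 0 < min |a| |b| := by
  have ha : a ≠ 0 := fun e => h0 ⟨e.le, e ▸ hab⟩
  have hb : b ≠ 0 := fun e => h0 ⟨e ▸ hab, e.ge⟩
  exact lt_min (abs_pos.2 ha) (abs_pos.2 hb)

/-- Two members of an interval not containing `0` have positive product (constant sign of `F'`)
[folklore]. -/
private theorem mul_pos_of_mem_Icc {a b d₁ d₂ : ℝ} (h0 : (0 : ℝ) ∉ Icc a b) (h₁ : d₁ ∈ Icc a b)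
    (h₂ : d₂ ∈ Icc a b) : 0 < d₁ * d₂ := by
  by_contra hle
  have hle' := not_lt.1 hle
  apply h0
  apply uIcc_subset_Icc h₁ h₂
  rcases mul_nonpos_iff.1 hle' with ⟨ha, hb⟩ | ⟨ha, hb⟩
  · exact mem_uIcc.2 (Or.inr ⟨hb, ha⟩)
  · exact mem_uIcc.2 (Or.inl ⟨ha, hb⟩)

/-- **Width of the Newton image (the metric step of Thm 5(b)).**  If `|d| ≥ δ > 0` on
`F'(X) = [d̲, d̄]` then any two points of `N(X) = m − f(m)/F'(X)` are within `|f(m)|·(d̄ − d̲)/δ²`: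
`y − z = f(m)(d₁ − d₂)/(d₁d₂)` with `|d₁ − d₂| ≤ d̄ − d̲` and `|d₁d₂| ≥ δ²`
[cite: AlefeldMayer2000, §3 Thm 5(b)]. -/
theorem abs_sub_le_width_of_mem_newtonSet {δ y z : ℝ} (hδ : 0 < δ) (hD : ∀ d ∈ Icc dl du, δ ≤ |d|)
    (hy : y ∈ newtonSet m fm (Icc dl du)) (hz : z ∈ newtonSet m fm (Icc dl du)) :
    |y - z| ≤ |fm| * (du - dl) / δ ^ 2 := by
  obtain ⟨d₁, hd₁, rfl⟩ := mem_newtonSet.1 hy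
  obtain ⟨d₂, hd₂, rfl⟩ := mem_newtonSet.1 hz
  have h₁ : δ ≤ |d₁| := hD d₁ hd₁
  have h₂ : δ ≤ |d₂| := hD d₂ hd₂
  have hd₁0 : d₁ ≠ 0 := by rintro rfl; rw [abs_zero] at h₁; exact absurd h₁ (not_le.2 hδ)
  have hd₂0 : d₂ ≠ 0 := by rintro rfl; rw [abs_zero] at h₂; exact absurd h₂ (not_le.2 hδ)
  have e : m - fm / d₁ - (m - fm / d₂) = fm * (d₁ - d₂) / (d₁ * d₂) := by
    field_simp
    ring
  rw [e, abs_div, abs_mul, abs_mul]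
  have hnum : |fm| * |d₁ - d₂| ≤ |fm| * (du - dl) := by
    refine mul_le_mul_of_nonneg_left ?_ (abs_nonneg _)
    rw [abs_le]
    constructor <;> linarith [hd₁.1, hd₁.2, hd₂.1, hd₂.2]
  have hden : δ ^ 2 ≤ |d₁| * |d₂| := by
    rw [pow_two]
    exact mul_le_mul h₁ h₂ hδ.le (abs_nonneg _)
  calc |fm| * |d₁ - d₂| / (|d₁| * |d₂|) ≤ |fm| * |d₁ - d₂| / δ ^ 2 :=
        div_le_div_of_nonneg_left (by positivity) (by positivity) hden
    _ ≤ |fm| * (du - dl) / δ ^ 2 := div_le_div_of_nonneg_right hnum (by positivity)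

/-- **Distance of the Newton image from the evaluation point.**  If `|d| ≤ M` on `F'(X) ∌ 0` then every
`y ∈ N(X)` has `|m − y| ≥ |f(m)|/M` [cite: AlefeldMayer2000, §4 (39)–(40)]. -/
theorem div_le_abs_sub_of_mem_newtonSet {M y : ℝ} (h0 : (0 : ℝ) ∉ Icc dl du)
    (hM : ∀ d ∈ Icc dl du, |d| ≤ M) (hy : y ∈ newtonSet m fm (Icc dl du)) :
    |fm| / M ≤ |m - y| := by
  obtain ⟨d, hd, rfl⟩ := mem_newtonSet.1 hy
  have hdpos : 0 < |d| := abs_pos.2 fun e => h0 (e ▸ hd)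
  rw [sub_sub_cancel, abs_div]
  exact div_le_div_of_nonneg_left (abs_nonneg _) hdpos (hM d hd)

/-- **The one-step divergence test** (univariate case of the "quadratic divergence" estimates): if
`m ∈ X = [lo, hi]`, `0 ∉ F'(X)`, `|F'(X)| ≤ M` and `|f(m)| > M·w(X)`, then `X ∩ N(X) = ∅` — every point
of `N(X)` is farther than `w(X)` from `m ∈ X` [cite: AlefeldMayer2000, §4 (37)–(40)]. -/
theorem Icc_inter_newtonSet_eq_empty {lo hi M : ℝ} (hm : m ∈ Icc lo hi) (h0 : (0 : ℝ) ∉ Icc dl du)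
    (hM : ∀ d ∈ Icc dl du, |d| ≤ M) (hlt : M * (hi - lo) < |fm|) :
    Icc lo hi ∩ newtonSet m fm (Icc dl du) = ∅ := by
  refine Set.eq_empty_of_subset_empty ?_
  rintro y ⟨hy, hyN⟩
  exfalso
  have h1 := div_le_abs_sub_of_mem_newtonSet h0 hM hyN
  obtain ⟨d, hd, rfl⟩ := mem_newtonSet.1 hyN
  have hMpos : 0 < M := (abs_pos.2 fun e => h0 (e ▸ hd)).trans_le (hM d hd)
  have h2 : |m - (m - fm / d)| ≤ hi - lo := by
    rw [abs_le]
    constructor <;> linarith [hm.1, hm.2, hy.1, hy.2]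
  have h3 := (div_le_iff₀ hMpos).1 (h1.trans h2)
  linarith

end OneStep

/-! ## Along a run -/

namespace IsNewtonRun

variable {f f' : ℝ → ℝ} {lo hi m dl du : ℕ → ℝ} (h : IsNewtonRun f f' lo hi m dl du)
include h

/-- A zero-free continuous `f` has one sign on `X⁽⁰⁾`: `f(x) f(y) > 0` for `x, y ∈ X⁽⁰⁾` (intermediate
value theorem; plumbing for the drift argument) [folklore]. -/
private theorem apply_mul_apply_pos {x y : ℝ} (hx : x ∈ Icc (lo 0) (hi 0)) (hy : y ∈ Icc (lo 0) (hi 0))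
    (hno : ∀ z ∈ Icc (lo 0) (hi 0), f z ≠ 0) : 0 < f x * f y := by
  by_contra hle
  have hle' := not_lt.1 hle
  have hsub : uIcc x y ⊆ Icc (lo 0) (hi 0) := uIcc_subset_Icc hx hy
  have h0 : (0 : ℝ) ∈ uIcc (f x) (f y) := by
    rcases mul_nonpos_iff.1 hle' with ⟨ha, hb⟩ | ⟨ha, hb⟩
    · exact mem_uIcc.2 (Or.inr ⟨hb, ha⟩)
    · exact mem_uIcc.2 (Or.inl ⟨ha, hb⟩)
  obtain ⟨z, hz, hfz⟩ := intermediate_value_uIcc ((h.continuousOn 0).mono hsub) h0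
  exact hno z (hsub hz) hfz

/-- **`|f(mₖ)| ≤ M·w(X⁽ᵏ⁾)`** when `f` has a zero `x ∈ X⁽⁰⁾` and `|F'(X⁽ᵏ⁾)| ≤ M`: the zero lies in
`N(X⁽ᵏ⁾)`, i.e. `x = mₖ − f(mₖ)/d` with `d ∈ F'(X⁽ᵏ⁾)`, so `|f(mₖ)| = |d|·|mₖ − x|` with both points in
`X⁽ᵏ⁾` (the mean-value step of Thm 5(b)) [cite: AlefeldMayer2000, §3 Thm 5(b)]. -/
theorem abs_apply_center_le_mul_width {M : ℝ} (hM : ∀ k, lo k ≤ hi k → ∀ d ∈ Icc (dl k) (du k), |d| ≤ M)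
    {x : ℝ} (hx : x ∈ Icc (lo 0) (hi 0)) (hfx : f x = 0) (k : ℕ) :
    |f (m k)| ≤ M * (hi k - lo k) := by
  have hxk := h.zero_mem hx hfx k
  have hk : lo k ≤ hi k := hxk.1.trans hxk.2
  obtain ⟨d, hd, hdeq⟩ := mem_newtonSet.1 (h.zero_mem_newtonSet hx hfx k)
  have hd0 : d ≠ 0 := fun hd' => h.zero_not_mem k hk (hd' ▸ hd)
  have hfm : f (m k) = d * (m k - x) := by
    have e : f (m k) / d = m k - x := by linarith
    rw [← e, mul_div_cancel₀ _ hd0]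
  have hmk := h.center_mem k hk
  rw [hfm, abs_mul]
  refine mul_le_mul (hM k hk d hd) ?_ (abs_nonneg _) ((abs_nonneg d).trans (hM k hk d hd))
  rw [abs_le]
  constructor <;> linarith [hmk.1, hmk.2, hxk.1, hxk.2]

/-- **Theorem 5(b) — quadratic convergence of the widths.**  Along a run with `X⁽ᵏ⁺¹⁾ ⊆ N(X⁽ᵏ⁾)`
(exact intersection), `δ ≤ |F'(X⁽ᵏ⁾)| ≤ M` and the Lipschitz-width hypothesis
`w(F'(X⁽ᵏ⁾)) ≤ c·w(X⁽ᵏ⁾)` ("`d f'([x]) ≤ c·d[x]`"), if `f` has a zero in `X⁽⁰⁾` then for every nonempty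
`X⁽ᵏ⁺¹⁾`: `w(X⁽ᵏ⁺¹⁾) ≤ (M c/δ²)·w(X⁽ᵏ⁾)²` — "`d[x]ᵏ⁺¹ ≤ γ (d[x]ᵏ)²`" with `γ = M c/δ²`
[cite: AlefeldMayer2000, §3 Thm 5(b)]. -/
theorem width_succ_le_mul_sq
    (hN : ∀ k, Icc (lo (k + 1)) (hi (k + 1)) ⊆ newtonSet (m k) (f (m k)) (Icc (dl k) (du k)))
    {δ M c : ℝ} (hδ : 0 < δ) (hδD : ∀ k, lo k ≤ hi k → ∀ d ∈ Icc (dl k) (du k), δ ≤ |d|)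
    (hM : ∀ k, lo k ≤ hi k → ∀ d ∈ Icc (dl k) (du k), |d| ≤ M)
    (hc : ∀ k, lo k ≤ hi k → du k - dl k ≤ c * (hi k - lo k))
    {x : ℝ} (hx : x ∈ Icc (lo 0) (hi 0)) (hfx : f x = 0) {k : ℕ} (hk : lo (k + 1) ≤ hi (k + 1)) :
    hi (k + 1) - lo (k + 1) ≤ M * c / δ ^ 2 * (hi k - lo k) ^ 2 := by
  have hk0 : lo k ≤ hi k := nonempty_Icc.1 (h.nonempty_of_le (Nat.le_succ k) (nonempty_Icc.2 hk))
  have hy := hN k (right_mem_Icc.2 hk)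
  have hz := hN k (left_mem_Icc.2 hk)
  have h1 := abs_sub_le_width_of_mem_newtonSet hδ (hδD k hk0) hy hz
  have h2 := h.abs_apply_center_le_mul_width hM hx hfx k
  have hD : 0 ≤ du k - dl k := by
    have hd := h.deriv_mem k (m k) (h.center_mem k hk0)
    exact sub_nonneg.2 (hd.1.trans hd.2)
  have hMw : 0 ≤ M * (hi k - lo k) := (abs_nonneg _).trans h2
  calc hi (k + 1) - lo (k + 1) ≤ |hi (k + 1) - lo (k + 1)| := le_abs_self _
    _ ≤ |f (m k)| * (du k - dl k) / δ ^ 2 := h1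
    _ ≤ M * (hi k - lo k) * (c * (hi k - lo k)) / δ ^ 2 :=
        div_le_div_of_nonneg_right (mul_le_mul h2 (hc k hk0) hD hMw) (by positivity)
    _ = M * c / δ ^ 2 * (hi k - lo k) ^ 2 := by ring

/-- **Theorem 5(b) with nested enclosures.**  If moreover `F'(X⁽ᵏ⁾) ⊆ F'(X⁽⁰⁾) = [d̲₀, d̄₀]` along the
run (inclusion isotonicity of the interval evaluation), the constants may be read off step `0`:
`w(X⁽ᵏ⁺¹⁾) ≤ (max(|d̲₀|,|d̄₀|)·c / min(|d̲₀|,|d̄₀|)²)·w(X⁽ᵏ⁾)²` [cite: AlefeldMayer2000, §3 Thm 5(b)]. -/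
theorem width_succ_le_mul_sq_of_subset
    (hN : ∀ k, Icc (lo (k + 1)) (hi (k + 1)) ⊆ newtonSet (m k) (f (m k)) (Icc (dl k) (du k)))
    (hD0 : ∀ k, lo k ≤ hi k → Icc (dl k) (du k) ⊆ Icc (dl 0) (du 0))
    {c : ℝ} (hc : ∀ k, lo k ≤ hi k → du k - dl k ≤ c * (hi k - lo k))
    {x : ℝ} (hx : x ∈ Icc (lo 0) (hi 0)) (hfx : f x = 0) {k : ℕ} (hk : lo (k + 1) ≤ hi (k + 1)) :
    hi (k + 1) - lo (k + 1) ≤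
      max |dl 0| |du 0| * c / (min |dl 0| |du 0|) ^ 2 * (hi k - lo k) ^ 2 := by
  have h00 : lo 0 ≤ hi 0 := hx.1.trans hx.2
  have h0D : (0 : ℝ) ∉ Icc (dl 0) (du 0) := h.zero_not_mem 0 h00
  have hd0 := h.deriv_mem 0 x hx
  have hmin : 0 < min |dl 0| |du 0| := min_abs_pos h0D (hd0.1.trans hd0.2)
  exact h.width_succ_le_mul_sq hN hmin (fun k hk d hd => (abs_bounds_of_mem h0D (hD0 k hk hd)).1)
    (fun k hk d hd => (abs_bounds_of_mem h0D (hD0 k hk hd)).2) hc hx hfx hk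

/-- **Divergence test along a run.**  If `X⁽ᵏ⁺¹⁾ ⊆ N(X⁽ᵏ⁾)`, `X⁽ᵏ⁾ ≠ ∅`, `|F'(X⁽ᵏ⁾)| ≤ M` and
`|f(mₖ)| > M·w(X⁽ᵏ⁾)`, then `X⁽ᵏ⁺¹⁾ = ∅` [cite: AlefeldMayer2000, §4 (37)–(40)]. -/
theorem lt_of_mul_width_lt
    (hN : ∀ k, Icc (lo (k + 1)) (hi (k + 1)) ⊆ newtonSet (m k) (f (m k)) (Icc (dl k) (du k)))
    {k : ℕ} {M : ℝ} (hk : lo k ≤ hi k) (hM : ∀ d ∈ Icc (dl k) (du k), |d| ≤ M)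
    (hlt : M * (hi k - lo k) < |f (m k)|) : hi (k + 1) < lo (k + 1) := by
  by_contra hge
  have hk1 := not_lt.1 hge
  have hmem : lo (k + 1) ∈ Icc (lo k) (hi k) ∩ newtonSet (m k) (f (m k)) (Icc (dl k) (du k)) :=
    ⟨h.succ_subset k (left_mem_Icc.2 hk1), hN k (left_mem_Icc.2 hk1)⟩
  rw [Icc_inter_newtonSet_eq_empty (h.center_mem k hk) (h.zero_not_mem k hk) hM hlt] at hmem
  simp at hmem

/-- **Theorem 5(c), "if", for ARBITRARY evaluation points, with a step count.**  Along a run with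
`X⁽ᵏ⁺¹⁾ ⊆ N(X⁽ᵏ⁾)` and nested enclosures `F'(X⁽ᵏ⁾) ⊆ F'(X⁽⁰⁾)`, if `|f| ≥ μ > 0` on `X⁽⁰⁾` then some
iterate `X⁽ᵏ⁾`, `k ≤ ⌊M·w(X⁽⁰⁾)/μ⌋ + 1` with `M = max(|d̲₀|,|d̄₀|)`, is EMPTY.  Proof (ours): while the
iterates are nonempty, `mₖ − mₖ₊₁ = f(mₖ)/dₖ` with `dₖ ∈ F'(X⁽⁰⁾)`; these differences have one sign
(`f` has no zero between two `m`'s, `F'(X⁽⁰⁾) ∌ 0`) and modulus `≥ μ/M`, so after `K` steps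
`|m_K − m₀| ≥ Kμ/M > w(X⁽⁰⁾)`, impossible inside `X⁽⁰⁾` [cite: AlefeldMayer2000, §3 Thm 5(c)]. -/
theorem exists_lt_of_le_abs
    (hN : ∀ k, Icc (lo (k + 1)) (hi (k + 1)) ⊆ newtonSet (m k) (f (m k)) (Icc (dl k) (du k)))
    (hD0 : ∀ k, lo k ≤ hi k → Icc (dl k) (du k) ⊆ Icc (dl 0) (du 0))
    {μ : ℝ} (hμ : 0 < μ) (hfμ : ∀ x ∈ Icc (lo 0) (hi 0), μ ≤ |f x|) :
    ∃ k ≤ ⌊max |dl 0| |du 0| * (hi 0 - lo 0) / μ⌋₊ + 1, hi k < lo k := by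
  set M := max |dl 0| |du 0| with hM
  set K := ⌊M * (hi 0 - lo 0) / μ⌋₊ + 1 with hK
  by_contra hcon
  simp only [not_exists, not_and, not_lt] at hcon
  -- `hcon : ∀ k ≤ K, lo k ≤ hi k`
  have hK1 : 0 + 1 ≤ K := by omega
  have h00 : lo 0 ≤ hi 0 := hcon 0 (Nat.zero_le _)
  have h0D : (0 : ℝ) ∉ Icc (dl 0) (du 0) := h.zero_not_mem 0 h00
  have hm0 : m 0 ∈ Icc (lo 0) (hi 0) := h.center_mem 0 h00
  have hno : ∀ z ∈ Icc (lo 0) (hi 0), f z ≠ 0 := by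
    intro z hz hfz
    have := hfμ z hz
    rw [hfz, abs_zero] at this
    exact absurd this (not_le.2 hμ)
  have hMpos : 0 < M := by
    have hd := h.deriv_mem 0 (m 0) hm0
    exact (abs_pos.2 fun e => h0D (e ▸ hd)).trans_le (abs_bounds_of_mem h0D hd).2
  have hμM : 0 < μ / M := div_pos hμ hMpos
  -- consecutive differences of evaluation points
  have hdiff : ∀ k, k + 1 ≤ K → ∃ d ∈ Icc (dl 0) (du 0), m k - m (k + 1) = f (m k) / d := by
    intro k hk1
    have hk0 : lo k ≤ hi k := hcon k (by omega)
    obtain ⟨d, hd, hdeq⟩ := mem_newtonSet.1 (hN k (h.center_mem (k + 1) (hcon (k + 1) hk1)))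
    exact ⟨d, hD0 k hk0 hd, by linarith⟩
  have hmem : ∀ k, k ≤ K → m k ∈ Icc (lo 0) (hi 0) := fun k hk =>
    h.antitone_Icc (Nat.zero_le k) (h.center_mem k (hcon k hk))
  -- their moduli are at least `μ / M`
  have habs : ∀ k, k + 1 ≤ K → μ / M ≤ |m k - m (k + 1)| := by
    intro k hk1
    obtain ⟨d, hd, e⟩ := hdiff k hk1
    have hdpos : 0 < |d| := abs_pos.2 fun hd0 => h0D (hd0 ▸ hd)
    rw [e, abs_div]
    calc μ / M ≤ μ / |d| := div_le_div_of_nonneg_left hμ.le hdpos (abs_bounds_of_mem h0D hd).2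
      _ ≤ |f (m k)| / |d| := div_le_div_of_nonneg_right (hfμ (m k) (hmem k (by omega))) (abs_nonneg d)
  -- and they all have the sign of the first one
  have hsign : ∀ k, k + 1 ≤ K → 0 < (m 0 - m (0 + 1)) * (m k - m (k + 1)) := by
    intro k hk1
    obtain ⟨d₁, hd₁, e₁⟩ := hdiff 0 hK1
    obtain ⟨d₂, hd₂, e₂⟩ := hdiff k hk1
    rw [e₁, e₂, div_mul_div_comm]
    exact div_pos (h.apply_mul_apply_pos hm0 (hmem k (by omega)) hno) (mul_pos_of_mem_Icc h0D hd₁ hd₂)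
  -- `K` steps of size `μ/M` do not fit into `X⁽⁰⁾`
  have hwK : hi 0 - lo 0 < K * (μ / M) := by
    have h1 : M * (hi 0 - lo 0) / μ < K := by
      rw [hK]
      push_cast
      exact Nat.lt_floor_add_one _
    rw [← div_lt_iff₀ hμM, div_div_eq_mul_div, mul_comm (hi 0 - lo 0) M]
    exact h1
  have hne1 : m 0 - m (0 + 1) ≠ 0 := by
    intro e
    have := habs 0 hK1
    rw [e, abs_zero] at this
    exact absurd this (not_le.2 hμM)
  have hmK := hmem K le_rfl
  rcases lt_or_gt_of_ne hne1 with hneg | hpos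
  · -- all differences negative: the `m k` increase by at least `μ/M` per step
    have drift : ∀ k, k ≤ K → m 0 + k * (μ / M) ≤ m k := by
      intro k
      induction k with
      | zero => intro; simp
      | succ k ih =>
        intro hk1
        have hs := hsign k hk1
        have hlt : m k - m (k + 1) < 0 := by
          rcases lt_or_ge (m k - m (k + 1)) 0 with hlt | hge
          · exact hlt
          · exact absurd hs (not_lt.2 (mul_nonpos_iff.2 (Or.inr ⟨hneg.le, hge⟩)))
        have hk := habs k hk1
        rw [abs_of_neg hlt] at hk
        have ih' := ih (by omega)
        have e : ((k + 1 : ℕ) : ℝ) * (μ / M) = (k : ℝ) * (μ / M) + μ / M := by push_cast; ring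
        rw [e]
        linarith
    have hd := drift K le_rfl
    linarith [hmK.2, hm0.1]
  · -- all differences positive: the `m k` decrease by at least `μ/M` per step
    have drift : ∀ k, k ≤ K → m k + k * (μ / M) ≤ m 0 := by
      intro k
      induction k with
      | zero => intro; simp
      | succ k ih =>
        intro hk1
        have hs := hsign k hk1
        have hgt : 0 < m k - m (k + 1) := by
          rcases lt_or_ge 0 (m k - m (k + 1)) with hgt | hle
          · exact hgt
          · exact absurd hs (not_lt.2 (mul_nonpos_iff.2 (Or.inl ⟨hpos.le, hle⟩)))
        have hk := habs k hk1
        rw [abs_of_pos hgt] at hk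
        have ih' := ih (by omega)
        have e : ((k + 1 : ℕ) : ℝ) * (μ / M) = (k : ℝ) * (μ / M) + μ / M := by push_cast; ring
        rw [e]
        linarith
    have hd := drift K le_rfl
    linarith [hmK.1, hm0.2]

/-- **Theorem 5(c), "if", qualitative.**  Along a run with `X⁽ᵏ⁺¹⁾ ⊆ N(X⁽ᵏ⁾)` and nested derivative
enclosures, if `f` has NO zero in `X⁽⁰⁾` then some iterate `X⁽ᵏ⁾ = [lo k, hi k]` is EMPTY (`μ = min |f| > 0`
on the compact `X⁽⁰⁾`) — for arbitrary evaluation points `mₖ ∈ X⁽ᵏ⁾` [cite: AlefeldMayer2000, §3 Thm 5(c)]. -/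
theorem exists_Icc_eq_empty_of_forall_ne_zero
    (hN : ∀ k, Icc (lo (k + 1)) (hi (k + 1)) ⊆ newtonSet (m k) (f (m k)) (Icc (dl k) (du k)))
    (hD0 : ∀ k, lo k ≤ hi k → Icc (dl k) (du k) ⊆ Icc (dl 0) (du 0))
    (hno : ∀ x ∈ Icc (lo 0) (hi 0), f x ≠ 0) : ∃ k, Icc (lo k) (hi k) = ∅ := by
  by_cases h00 : lo 0 ≤ hi 0
  · obtain ⟨x₀, hx₀, hmin⟩ := isCompact_Icc.exists_isMinOn (nonempty_Icc.2 h00)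
      (continuous_abs.comp_continuousOn (h.continuousOn 0))
    have hμ : 0 < |f x₀| := abs_pos.2 (hno x₀ hx₀)
    obtain ⟨k, -, hk⟩ := h.exists_lt_of_le_abs hN hD0 hμ fun x hx => (isMinOn_iff.1 hmin) x hx
    exact ⟨k, Icc_eq_empty_of_lt hk⟩
  · exact ⟨0, Icc_eq_empty h00⟩

/-- **Theorem 5(c) — the termination dichotomy for arbitrary evaluation points.**  Along a run with
`X⁽ᵏ⁺¹⁾ ⊆ N(X⁽ᵏ⁾)` and nested derivative enclosures: some iterate is empty iff `f` has no zero in `X⁽⁰⁾`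
(`UnivariateIntervalNewtonIteration.lean` proved this for midpoint runs, as `∃ k, hi k < lo k`)
[cite: AlefeldMayer2000, §3 Thm 5(c)]. -/
theorem exists_Icc_eq_empty_iff_forall_ne_zero
    (hN : ∀ k, Icc (lo (k + 1)) (hi (k + 1)) ⊆ newtonSet (m k) (f (m k)) (Icc (dl k) (du k)))
    (hD0 : ∀ k, lo k ≤ hi k → Icc (dl k) (du k) ⊆ Icc (dl 0) (du 0)) :
    (∃ k, Icc (lo k) (hi k) = ∅) ↔ ∀ x ∈ Icc (lo 0) (hi 0), f x ≠ 0 :=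
  ⟨fun ⟨_, hk⟩ => h.forall_ne_zero_of_lt (not_le.1 (Icc_eq_empty_iff.1 hk)),
    h.exists_Icc_eq_empty_of_forall_ne_zero hN hD0⟩

end IsNewtonRun

/-! ## Moore's exact midpoint runs: both rates, and the logarithmic step count -/

namespace IsExactNewtonRun

variable {f f' : ℝ → ℝ} {lo hi m dl du : ℕ → ℝ} (h : IsExactNewtonRun f f' lo hi m dl du)
include h

/-- **Quadratic convergence of Moore's (5.16)** under `w(F'(X⁽ᵏ⁾)) ≤ c·w(X⁽ᵏ⁾)`, with the constants
of step `0`: `w(X⁽ᵏ⁺¹⁾) ≤ (max(|d̲₀|,|d̄₀|)·c / min(|d̲₀|,|d̄₀|)²)·w(X⁽ᵏ⁾)²` whenever `f` has a zero in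
`X⁽⁰⁾` and `X⁽ᵏ⁺¹⁾ ≠ ∅` [cite: AlefeldMayer2000, §3 Thm 5(b)]. -/
theorem width_succ_le_mul_sq {c : ℝ} (hc : ∀ k, lo k ≤ hi k → du k - dl k ≤ c * (hi k - lo k))
    {x : ℝ} (hx : x ∈ Icc (lo 0) (hi 0)) (hfx : f x = 0) {k : ℕ} (hk : lo (k + 1) ≤ hi (k + 1)) :
    hi (k + 1) - lo (k + 1) ≤
      max |dl 0| |du 0| * c / (min |dl 0| |du 0|) ^ 2 * (hi k - lo k) ^ 2 :=
  h.toIsNewtonRun.width_succ_le_mul_sq_of_subset h.succ_subset_newtonSet h.deriv_Icc_subset_zero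
    hc hx hfx hk

/-- **Both rates at once**: halving [cite: Moore1979, §5.2 Thm 5.5] and the quadratic bound
[cite: AlefeldMayer2000, §3 Thm 5(b)] — linear far from the zero, quadratic near it. -/
theorem width_succ_le_min {c : ℝ} (hc : ∀ k, lo k ≤ hi k → du k - dl k ≤ c * (hi k - lo k))
    {x : ℝ} (hx : x ∈ Icc (lo 0) (hi 0)) (hfx : f x = 0) {k : ℕ} (hk : lo (k + 1) ≤ hi (k + 1)) :
    hi (k + 1) - lo (k + 1) ≤
      min ((hi k - lo k) / 2) (max |dl 0| |du 0| * c / (min |dl 0| |du 0|) ^ 2 * (hi k - lo k) ^ 2) :=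
  le_min (h.width_succ_le hk) (h.width_succ_le_mul_sq hc hx hfx hk)

/-- **Linear step count** (Thm 5(c) for the midpoint run, via the drift argument): `|f| ≥ μ > 0` on
`X⁽⁰⁾` forces an empty iterate at some `k ≤ ⌊max(|d̲₀|,|d̄₀|)·w(X⁽⁰⁾)/μ⌋ + 1`
[cite: AlefeldMayer2000, §3 Thm 5(c)]. -/
theorem exists_lt_le_of_le_abs {μ : ℝ} (hμ : 0 < μ) (hfμ : ∀ x ∈ Icc (lo 0) (hi 0), μ ≤ |f x|) :
    ∃ k ≤ ⌊max |dl 0| |du 0| * (hi 0 - lo 0) / μ⌋₊ + 1, hi k < lo k :=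
  h.toIsNewtonRun.exists_lt_of_le_abs h.succ_subset_newtonSet h.deriv_Icc_subset_zero hμ hfμ

/-- **Logarithmic step count for midpoint runs** ("`k₀` is small if the diameter of `[x]⁰` is
small"): if `|f| ≥ μ > 0` on `X⁽⁰⁾` and `w(X⁽⁰⁾) < (μ/M)·2ⁿ`, `M = max(|d̲₀|,|d̄₀|)`, then some `X⁽ᵏ⁾`
with `k ≤ n + 1` is empty — by halving `w(X⁽ⁿ⁾) ≤ 2⁻ⁿ w(X⁽⁰⁾) < μ/M ≤ |f(mₙ)|/M`, and then the
divergence test empties `X⁽ⁿ⁺¹⁾` [cite: AlefeldMayer2000, §4 (37)–(40); §3 Thm 5(c)]. -/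
theorem exists_lt_of_width_lt {μ : ℝ} (hfμ : ∀ x ∈ Icc (lo 0) (hi 0), μ ≤ |f x|)
    {n : ℕ} (hw : hi 0 - lo 0 < μ / max |dl 0| |du 0| * 2 ^ n) : ∃ k ≤ n + 1, hi k < lo k := by
  by_contra hcon
  simp only [not_exists, not_and, not_lt] at hcon
  have h00 : lo 0 ≤ hi 0 := hcon 0 (Nat.zero_le _)
  have hn : lo n ≤ hi n := hcon n (Nat.le_succ n)
  have hn1 : lo (n + 1) ≤ hi (n + 1) := hcon (n + 1) le_rfl
  set M := max |dl 0| |du 0| with hM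
  have h0D : (0 : ℝ) ∉ Icc (dl 0) (du 0) := h.zero_not_mem 0 h00
  have hMbd : ∀ d ∈ Icc (dl n) (du n), |d| ≤ M := fun d hd =>
    (abs_bounds_of_mem h0D (h.deriv_Icc_subset_zero n hn hd)).2
  have hMpos : 0 < M := by
    have hd := h.deriv_mem 0 (m 0) (h.center_mem 0 h00)
    exact (abs_pos.2 fun e => h0D (e ▸ hd)).trans_le (abs_bounds_of_mem h0D hd).2
  have hmn : m n ∈ Icc (lo 0) (hi 0) := h.antitone_Icc (Nat.zero_le n) (h.center_mem n hn)
  have hwn : hi n - lo n ≤ (hi 0 - lo 0) / 2 ^ n := h.width_le_div_pow n hn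
  have h2 : (hi 0 - lo 0) / 2 ^ n < μ / M := by
    rw [div_lt_iff₀ (by positivity)]
    exact hw
  have h3 := (lt_div_iff₀ hMpos).1 h2
  have hlt : M * (hi n - lo n) < |f (m n)| := by
    have h1 : M * (hi n - lo n) ≤ M * ((hi 0 - lo 0) / 2 ^ n) := mul_le_mul_of_nonneg_left hwn hMpos.le
    linarith [hfμ (m n) hmn]
  exact absurd (h.toIsNewtonRun.lt_of_mul_width_lt h.succ_subset_newtonSet hn hMbd hlt) (not_lt.2 hn1)

end IsExactNewtonRun

/-! ## Worked numbers: the second step of the `x² − 2` run -/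

section SqrtTwo

/-- The one-step width bound on the second step of the `√2` run of the two earlier files
(`m = 45/32`, `F'(X⁽¹⁾) = [11/4, 23/8]`, `δ = 11/4`, `N(X⁽¹⁾) = [181/128, 3983/2816]`):
`w(N(X⁽¹⁾)) ≤ |f(m)|·(d̄ − d̲)/δ²` [cite: AlefeldMayer2000, §3 Thm 5(b)]. -/
theorem sqrtTwo_step_two_width_le :
    |(3983 / 2816 : ℝ) - 181 / 128| ≤ |(45 / 32 : ℝ) ^ 2 - 2| * (23 / 8 - 11 / 4) / (11 / 4) ^ 2 := by
  have hN := sqrtTwo_newtonSet_step_two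
  refine abs_sub_le_width_of_mem_newtonSet (m := 45 / 32) (by norm_num)
    (fun d hd => hd.1.trans (le_abs_self d)) ?_ ?_
  · rw [hN]; exact right_mem_Icc.2 (by norm_num)
  · rw [hN]; exact left_mem_Icc.2 (by norm_num)

/-- … in numbers: the true width is `1/2816 ≈ 3.55·10⁻⁴`, the a-priori bound `23/61952 ≈ 3.71·10⁻⁴`
(halving promised only `w(X⁽¹⁾)/2 = 1/32`) [cite: AlefeldMayer2000, §3 Thm 5(b)]. -/
theorem sqrtTwo_step_two_width_numbers :
    (3983 / 2816 : ℝ) - 181 / 128 = 1 / 2816 ∧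
      |(45 / 32 : ℝ) ^ 2 - 2| * (23 / 8 - 11 / 4) / (11 / 4) ^ 2 = 23 / 61952 ∧
      (1 / 2816 : ℝ) < 23 / 61952 ∧ (23 / 16 - 11 / 8 : ℝ) / 2 = 1 / 32 := by
  refine ⟨by norm_num, ?_, by norm_num, by norm_num⟩
  rw [show (45 / 32 : ℝ) ^ 2 - 2 = -(23 / 1024) by norm_num, abs_neg, abs_of_pos (by norm_num)]
  norm_num

end SqrtTwo

end Literature.Analysis.ValidatedNumerics.IntervalNewton
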